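import Summits.ValiantsHypothesis.ValiantsHypothesis.Theorems.NewtonUnitEquationsTwoProductsPlanarCellBlockMerge

/-!
# Crux `TwoProducts` (stmt-ValiantsHypothesis-5906) — rung R11 «freiman-ray-split», Stage 1: DEFINITIONS
# (typed block of the tree card `Cruxes/TwoProducts/Ideas/freiman-ray-split.md` ll. 46–52 @a629771f54a8, val-idea-32 g0, VERBATIM; definition lane)

Pen act (val-port-1 g2, 5906 Cruxes pen; desk g13 RULINGS #316/#317/#318, director R282 (7)(b)): the rung statement's vocabulary in an
importable `Theorems/` module, so that the Stage-1 prover (val-port-3 g2 per #310 (D), or whoever the desk names) proves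
`RaySplitLaw` / `RaySplitCellLaw` BY NAME and the Cruxes record `Lines/relation_ladder_sketch_R11.lean` re-exports it (one source of truth).
Texts = the card's typed block verbatim, over the landed `PlanarCell.tuples` / `PlanarCell.tailSupport` / `PlanarCell.IsCellFamily` and
`FormalLogLinearisation.visible` (val-idea-32's seat-folder `Sketch.lean`, rc 0 there, is not mounted for the pen; the card carries the same texts):

* `IndepRays g` — the `K` rays `g i ∈ Expo` are pairwise non-parallel;
* `OnRays g ι ν E` — every letter `e ∈ E` lies on its ray: `e = ν e • g (ι e)`;
* `raySum ι i a` — the part of the tuple sum `Σ_j a j` carried by ray `i`;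
* `RayCrossFree ι A` — NO CROSS COINCIDENCES between rays: two letter tuples with the same sum have the same ray sums, ray by ray
  (Freiman-injectivity of the realised module; in-ray coincidences of any rank are allowed);
* `RaySplitLaw` — **Stage 1**: `K` independent rays ∧ letters on rays ∧ ray-cross-free ⇒ `#visible ≤ 2^((m+1)·K)` (t-FREE; `K` sits in the
  exponent — honest: the law buys t-freeness with the explicit hypothesis «K rays», cf. `not_twoProductsBoundFreeOfT/M`);
* `RaySplitCellLaw` — the same in the per-cell currency (`IsCellFamily u v R S → #S ≤ 2^((m+1)·K)`).

SCOPE LABEL: statement typing only — a proper POSITIVE SUB-CASE rung (crit-8 verdict on the card), NOT the residual; nothing here closes 5906;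
`ResidualLawV21` / `PlanarCellBound` / `TwoProducts` OPEN; VP ≠ VNP is NOT proved.  Credit: val-idea-32 g0 (statements), val-idea-crit-8 (critic of record).
-/

set_option linter.dupNamespace false

noncomputable section

namespace Summit.ValiantsHypothesis.ValiantsHypothesis.Theorems.NewtonUnitEquations.TwoProducts.RaySplit
open scoped BigOperators
open MvPolynomial
open Summit.ValiantsHypothesis.ValiantsHypothesis.Theorems.NewtonUnitEquations.TwoProducts.FormalLogLinearisation
open Summit.ValiantsHypothesis.ValiantsHypothesis.Theorems.NewtonUnitEquations.TwoProducts.PlanarCell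

variable {m : ℕ}

/-- INDEPENDENT RAYS: the direction vectors `g i ∈ ℕ²` are pairwise non-parallel. [val-idea-32, card l.48] -/
def IndepRays {K : ℕ} (g : Fin K → Expo) : Prop :=
  ∀ i i' : Fin K, i ≠ i' → (g i) 0 * (g i') 1 ≠ (g i) 1 * (g i') 0

/-- LETTERS ON RAYS: every letter `e ∈ E` is `ν e • g (ι e)` — it lies on the ray `ι e` with in-ray multiplicity `ν e`.
[val-idea-32, card l.48] -/
def OnRays {K : ℕ} (g : Fin K → Expo) (ι : Expo → Fin K) (ν : Expo → ℕ) (E : Finset Expo) : Prop :=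
  ∀ e ∈ E, e = ν e • g (ι e)

/-- The RAY SUM of a letter tuple on ray `i`: `Σ_j [ι (a j) = i] · a j`. [val-idea-32, card l.48–49] -/
def raySum {K : ℕ} (ι : Expo → Fin K) (i : Fin K) (a : Fin m → Expo) : Expo :=
  ∑ j, if ι (a j) = i then a j else 0

/-- RAY-CROSS-FREE: two letter tuples with the same sum have the same ray sums, ray by ray (no coincidence moves mass
ACROSS rays; in-ray coincidences of any rank are allowed). [val-idea-32, card l.49] -/
def RayCrossFree {K : ℕ} (ι : Expo → Fin K) (A : Fin m → Finset Expo) : Prop :=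
  ∀ a ∈ tuples A, ∀ b ∈ tuples A, ∑ j, a j = ∑ j, b j → ∀ i, raySum ι i a = raySum ι i b

/-- **R11, Stage 1 — the RAY-SPLIT LAW (t-free visible count).**  For normalised pairs `(u, v)` whose letters lie on
`K` independent rays with no cross-ray coincidences, `#visible ≤ 2^((m+1)·K)`. [val-idea-32, card l.46–50] -/
def RaySplitLaw : Prop :=
  ∀ (K m : ℕ) (g : Fin K → Expo) (ι : Expo → Fin K) (ν : Expo → ℕ) (u v : Fin m → MvPolynomial (Fin 2) ℂ),
    IndepRays g → (∀ j, coeff 0 (u j) = 0) → (∀ j, coeff 0 (v j) = 0) →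
    OnRays g ι ν (tailSupport u v) → RayCrossFree ι (fun j => (u j).support ∪ (v j).support) →
    (visible u v).ncard ≤ 2 ^ ((m + 1) * K)

/-- **R11, Stage 1 — cell form** (the `relation_ladder` currency: every cell family `S` of a ray-split instance has
`#S ≤ 2^((m+1)·K)`; via `visible = logVisible` this follows from `RaySplitLaw`). [val-idea-32, card l.50] -/
def RaySplitCellLaw : Prop :=
  ∀ (K m : ℕ) (g : Fin K → Expo) (ι : Expo → Fin K) (ν : Expo → ℕ) (u v : Fin m → MvPolynomial (Fin 2) ℂ),
    IndepRays g → (∀ j, coeff 0 (u j) = 0) → (∀ j, coeff 0 (v j) = 0) →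
    OnRays g ι ν (tailSupport u v) → RayCrossFree ι (fun j => (u j).support ∪ (v j).support) →
    ∀ (R : Expo → Expo → Prop) (S : Finset Expo), IsCellFamily u v R S → S.card ≤ 2 ^ ((m + 1) * K)

end Summit.ValiantsHypothesis.ValiantsHypothesis.Theorems.NewtonUnitEquations.TwoProducts.RaySplit

end
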